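import Literature.NumberTheory.NumberFields.ClassGroupNormGalois
import HarnessLib

/-!
# Kuroda's class number relation, odd part, for a biquadratic layer `L/k` inside a Galois extension —
# and the dihedral/semidihedral descent `#Cl(L)[q]·#Cl(k)[q]² = #Cl(X)[q]·#Cl(K)[q]²`

Topic `NumberTheory/NumberFields`.  THEOREM-ONLY file (no definition, no named fact, no `sorry`), written by
the literature seat `bsd-potss-conjA-anchor` g8 (cell `bsd-potss`; `--supports` stmt-BirchSwinnertonDyer-19942;
closes nothing) as the kernel form of the descent used by its `p = 3` census (memo
`pub/bsd-potss/conjA-anchor/g8/FINDING-19942-19386-fukuda-mu-road-conjA-anchor-g8.md` §1).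

## Statement

Let `L/F` be a finite Galois extension of number fields and `z, b ∈ Gal(L/F)` commuting involutions
(`z² = b² = 1`, `zb = bz`), `V = ⟨z, b⟩`, and `q` an ODD natural number.  Write
`N_E(q) = #{c ∈ Cl(E) : c^q = 1}` for a number field `E`.  Then (Kuroda's relation, `q`-torsion form, for
the biquadratic extension `L/L^V` with intermediate fields `L^⟨z⟩, L^⟨b⟩, L^⟨zb⟩`):
  `N_L(q) · N_{L^V}(q)² = N_{L^⟨z⟩}(q) · N_{L^⟨b⟩}(q) · N_{L^⟨zb⟩}(q)`,
and if moreover `zb = g b g⁻¹` for some `g ∈ Gal(L/F)` (e.g. `G = D₄` or `SD₁₆`, `z` central, `b` a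
non-central involution) then `N_{L^⟨zb⟩}(q) = N_{L^⟨b⟩}(q)`, so
  `N_L(q) · N_{L^V}(q)² = N_{L^⟨z⟩}(q) · N_{L^⟨b⟩}(q)²`.
With `q = p` an odd prime this is the `p`-RANK relation, with `q = p^n ≥ exp Cl[p^∞]` the ORDER relation
`e(L) + 2e(k) = e(X) + 2e(K)` of the `p`-parts.

## Proof (elementary; no character theory)

(1) For a finite abelian group `M` of odd exponent and an involutive endomorphism `s`,
`#M = #M^{s} · #M^{s,−}` where `M^{s,−} = {m : s m = m⁻¹}`: the endomorphism `φ(m) = m·s(m)` has kernel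
`M^{s,−}` and image `M^{s}` (`u = φ(u^{(q+1)/2})` for `u ∈ M^s`).  (2) Applying (1) to `(M, z)`, `(M^z, b)`,
`(M^{z,−}, b)`, `(M^b, z)`, `(M^{zb}, z)` and comparing gives `#M·(#M^V)² = #M^z·#M^b·#M^{zb}`.
(3) For `H ≤ Gal(L/F)` of order prime to `q`, extension of ideals is a bijection
`{d ∈ Cl(L^H) : d^q = 1} → {c ∈ Cl(L) : c^q = 1, H c = c}` (injective by Neukirch III (1.6)(ii),
`classGroupExtend_eq_one_iff_of_coprime`; surjective by (1.6)(iv), `c^{#H} = i(N c)` for invariant `c`,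
`pow_finrank_eq_classGroupExtend_classGroupNorm_of_forall_smul_eq`).  (4) `c ↦ g c` carries the `b`-fixed
classes onto the `g b g⁻¹ = zb`-fixed ones.

References: [NeukirchANT1999] Ch. III §1 Prop. (1.6) (ii), (iv); [Washington1997] §10.1; [Lemmermeyer1994]
F. Lemmermeyer, Kuroda's class number formula, Acta Arith. 66 (1994) 245–260, §1 (the formula; here only its
odd part, in torsion-counting form); C. D. Walter, Brauer's class number relation, Acta Arith. 35 (1979) 33–40.
-/

noncomputable section

open scoped Classical NumberField nonZeroDivisors

namespace Literature.NumberTheory.NumberFields.KurodaOddPart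

open IsDedekindDomain Literature.NumberTheory.NumberFields

/-! ### §1 Finite abelian groups of odd exponent with an involutive endomorphism -/

section Group

variable {M : Type*} [CommGroup M]

/-- `#N = #{m ∈ N : s m = m} · #{m ∈ N : s m = m⁻¹}` for a subgroup `N` of a commutative group, stable under
an involutive endomorphism `s`, all of whose elements satisfy `m^q = 1` with `q` odd: the endomorphism
`m ↦ m · s m` of `N` has kernel the anti-fixed and image the fixed elements (`u = φ(u^{(q+1)/2})`). [folklore] -/
private theorem card_eq_card_fixed_mul_card_anti (N : Subgroup M) [Finite N] (s : M →* M)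
    (hs : ∀ m, s (s m) = m) (hsN : ∀ m ∈ N, s m ∈ N) {q : ℕ} (hq : Odd q) (hN : ∀ m ∈ N, m ^ q = 1) :
    Nat.card N = Nat.card {m : M // m ∈ N ∧ s m = m} * Nat.card {m : M // m ∈ N ∧ s m = m⁻¹} := by
  -- the endomorphism `φ(m) = m · s m` of `N`
  let φ : N →* N :=
    { toFun := fun m => ⟨m.1 * s m.1, N.mul_mem m.2 (hsN _ m.2)⟩
      map_one' := by ext; simp
      map_mul' := by
        intro x y; ext
        simp only [Subgroup.coe_mul, map_mul]
        rw [mul_mul_mul_comm] }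
  have hφ : ∀ m : N, ((φ m : N) : M) = m.1 * s m.1 := fun m => rfl
  have hker_iff : ∀ m : N, m ∈ φ.ker ↔ s m.1 = (m.1)⁻¹ := by
    intro m
    rw [MonoidHom.mem_ker, Subtype.ext_iff, hφ, OneMemClass.coe_one]
    exact ⟨eq_inv_of_mul_eq_one_right, fun h => by rw [h, mul_inv_cancel]⟩
  have hrange_iff : ∀ m : N, m ∈ φ.range ↔ s m.1 = m.1 := by
    intro m
    constructor
    · rintro ⟨x, hx⟩
      have h1 : (m.1 : M) = x.1 * s x.1 := by rw [← hφ, hx]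
      rw [h1, map_mul, hs, mul_comm]
    · intro hm
      -- `u = φ(u^(k+1))` with `q = 2k+1`
      obtain ⟨k, hk⟩ := hq
      refine ⟨m ^ (k + 1), ?_⟩
      ext
      rw [hφ]
      simp only [SubmonoidClass.coe_pow, map_pow]
      rw [hm, ← pow_add, show k + 1 + (k + 1) = q + 1 by omega, pow_succ, hN _ m.2, one_mul]
  have hker : Nat.card φ.ker = Nat.card {m : M // m ∈ N ∧ s m = m⁻¹} :=
    Nat.card_congr
      { toFun := fun m => ⟨m.1.1, m.1.2, (hker_iff m.1).mp m.2⟩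
        invFun := fun m => ⟨⟨m.1, m.2.1⟩, (hker_iff ⟨m.1, m.2.1⟩).mpr m.2.2⟩
        left_inv := fun m => by ext; rfl
        right_inv := fun m => by ext; rfl }
  have hrange : Nat.card φ.range = Nat.card {m : M // m ∈ N ∧ s m = m} :=
    Nat.card_congr
      { toFun := fun m => ⟨m.1.1, m.1.2, (hrange_iff m.1).mp m.2⟩
        invFun := fun m => ⟨⟨m.1, m.2.1⟩, (hrange_iff ⟨m.1, m.2.1⟩).mpr m.2.2⟩
        left_inv := fun m => by ext; rfl
        right_inv := fun m => by ext; rfl }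
  rw [← hker, ← hrange, Subgroup.card_eq_card_quotient_mul_card_subgroup φ.ker,
    Nat.card_congr (QuotientGroup.quotientKerEquivRange φ).toEquiv]

/-- **The odd-part V4 identity**: for commuting involutive endomorphisms `z, b` of a finite commutative
group and an odd `q`, counting elements with `m^q = 1`:
`#M[q] · (#M[q]^{⟨z,b⟩})² = #M[q]^{z} · #M[q]^{b} · #M[q]^{zb}`. [folklore] -/
private theorem card_torsion_mul_card_fixed_sq [Finite M] (z b : M →* M) (hz : ∀ m, z (z m) = m)
    (hb : ∀ m, b (b m) = m) (hzb : ∀ m, z (b m) = b (z m)) {q : ℕ} (hq : Odd q) :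
    Nat.card {m : M // m ^ q = 1} * Nat.card {m : M // m ^ q = 1 ∧ z m = m ∧ b m = m} ^ 2 =
      Nat.card {m : M // m ^ q = 1 ∧ z m = m} * Nat.card {m : M // m ^ q = 1 ∧ b m = m} *
        Nat.card {m : M // m ^ q = 1 ∧ z (b m) = m} := by
  have pow_mem : ∀ {m : M}, m ^ q = 1 → ∀ (f : M →* M), (f m) ^ q = 1 := fun h f => by
    rw [← map_pow, h, map_one]
  -- generic stable subgroup `{m : m^q = 1 ∧ P m}` given as `T ⊓ S`
  let T : Subgroup M := (powMonoidHom q : M →* M).ker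
  have hT : ∀ m, m ∈ T ↔ m ^ q = 1 := fun m => by
    change powMonoidHom q m = 1 ↔ _; rw [powMonoidHom_apply]
  let Fz : Subgroup M := T ⊓ z.eqLocus (MonoidHom.id M)
  let Az : Subgroup M := T ⊓ ((MonoidHom.id M) * z).ker
  let Fb : Subgroup M := T ⊓ b.eqLocus (MonoidHom.id M)
  let Fzb : Subgroup M := T ⊓ (z.comp b).eqLocus (MonoidHom.id M)
  have mFz : ∀ m, m ∈ Fz ↔ m ^ q = 1 ∧ z m = m := fun m => by
    change m ∈ T ∧ z m = m ↔ _; rw [hT]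
  have mAz : ∀ m, m ∈ Az ↔ m ^ q = 1 ∧ z m = m⁻¹ := fun m => by
    change m ∈ T ∧ m * z m = 1 ↔ _; rw [hT]
    exact and_congr_right fun _ => ⟨eq_inv_of_mul_eq_one_right, fun h => by rw [h, mul_inv_cancel]⟩
  have mFb : ∀ m, m ∈ Fb ↔ m ^ q = 1 ∧ b m = m := fun m => by
    change m ∈ T ∧ b m = m ↔ _; rw [hT]
  have mFzb : ∀ m, m ∈ Fzb ↔ m ^ q = 1 ∧ z (b m) = m := fun m => by
    change m ∈ T ∧ z (b m) = m ↔ _; rw [hT]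
  -- the four "atoms": A = #F(z,b), B = #(Fz ∩ Anti b), C = #(Anti z ∩ Fb), D = #(Anti z ∩ Anti b)
  set A := Nat.card {m : M // m ^ q = 1 ∧ z m = m ∧ b m = m} with hA
  set B := Nat.card {m : M // m ∈ Fz ∧ b m = m⁻¹} with hB
  set C := Nat.card {m : M // m ∈ Az ∧ b m = m} with hC
  set D := Nat.card {m : M // m ∈ Az ∧ b m = m⁻¹} with hD
  -- (a) `#T = #Fz · #Az`
  have ea : Nat.card {m : M // m ^ q = 1} = Nat.card Fz * Nat.card Az := by
    have := card_eq_card_fixed_mul_card_anti T z hz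
      (fun m hm => (hT _).mpr (pow_mem ((hT m).mp hm) z)) hq (fun m hm => (hT m).mp hm)
    rw [Nat.card_congr (Equiv.subtypeEquivRight fun m => (hT m).symm), this]
    congr 1
    exact Nat.card_congr (Equiv.subtypeEquivRight fun m => by simp only [mAz, hT])
  -- (b) `#Fz = A · B`
  have eb : Nat.card Fz = A * B := by
    have := card_eq_card_fixed_mul_card_anti Fz b hb (fun m hm => by
      rw [mFz] at hm ⊢; exact ⟨pow_mem hm.1 b, by rw [hzb, hm.2]⟩) hq (fun m hm => ((mFz m).mp hm).1)
    rw [this, hA]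
    congr 1
    exact Nat.card_congr (Equiv.subtypeEquivRight fun m => by rw [mFz, and_assoc])
  -- (c) `#Az = C · D`
  have ec : Nat.card Az = C * D :=
    card_eq_card_fixed_mul_card_anti Az b hb (fun m hm => by
      rw [mAz] at hm ⊢; exact ⟨pow_mem hm.1 b, by rw [hzb, hm.2, map_inv]⟩) hq
      (fun m hm => ((mAz m).mp hm).1)
  -- (d) `#Fb = A · C`
  have ed : Nat.card {m : M // m ^ q = 1 ∧ b m = m} = A * C := by
    have := card_eq_card_fixed_mul_card_anti Fb z hz (fun m hm => by
      rw [mFb] at hm ⊢; exact ⟨pow_mem hm.1 z, by rw [← hzb, hm.2]⟩) hq (fun m hm => ((mFb m).mp hm).1)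
    rw [Nat.card_congr (Equiv.subtypeEquivRight fun m => (mFb m).symm), this, hA, hC]
    congr 1
    · exact Nat.card_congr (Equiv.subtypeEquivRight fun m => by
        rw [mFb, and_assoc]; exact and_congr_right fun _ => and_comm)
    · exact Nat.card_congr (Equiv.subtypeEquivRight fun m => by rw [mFb, mAz]; tauto)
  -- (e) `#Fzb = A · D`
  have ee : Nat.card {m : M // m ^ q = 1 ∧ z (b m) = m} = A * D := by
    have := card_eq_card_fixed_mul_card_anti Fzb z hz (fun m hm => by
      rw [mFzb] at hm ⊢
      refine ⟨pow_mem hm.1 z, ?_⟩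
      have h3 : b m = z m := by have := congrArg z hm.2; rwa [hz] at this
      rw [hzb, hz]; exact h3) hq (fun m hm => ((mFzb m).mp hm).1)
    rw [Nat.card_congr (Equiv.subtypeEquivRight fun m => (mFzb m).symm), this, hA, hD]
    congr 1
    · refine Nat.card_congr (Equiv.subtypeEquivRight fun m => ?_)
      rw [mFzb, and_assoc]
      refine and_congr_right fun _ => ?_
      constructor
      · rintro ⟨h1, h2⟩
        refine ⟨h2, ?_⟩
        have := congrArg z h1; rwa [hz, h2] at this
      · rintro ⟨h1, h2⟩
        exact ⟨by rw [h2, h1], h1⟩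
    · refine Nat.card_congr (Equiv.subtypeEquivRight fun m => ?_)
      simp only [mFzb, mAz, and_assoc]
      refine and_congr_right fun _ => ?_
      constructor
      · rintro ⟨h1, h2⟩
        refine ⟨h2, ?_⟩
        have := congrArg z h1; rw [hz] at this; rw [this]; exact h2
      · rintro ⟨h1, h2⟩
        exact ⟨by rw [h2, map_inv, h1, inv_inv], h1⟩
  -- assemble
  have ez : Nat.card {m : M // m ^ q = 1 ∧ z m = m} = Nat.card Fz :=
    Nat.card_congr (Equiv.subtypeEquivRight fun m => (mFz m).symm)
  rw [ea, ez, eb, ec, ed, ee]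
  ring

end Group

/-! ### §2 Class groups: `q`-torsion of `Cl(L^H)` = `H`-fixed `q`-torsion of `Cl(L)` for `gcd(q, #H) = 1` -/

section ClassGroup

open NumberField

variable (F L : Type) [Field F] [NumberField F] [Field L] [NumberField L] [Algebra F L] [IsGalois F L]

omit [IsGalois F L] in
/-- Extended classes are Galois-invariant: `σ · i_{L/E}(d) = i_{L/E}(d)` for `σ ∈ Gal(L/E)`
(`σ(𝔞𝓞_L) = 𝔞𝓞_L`). [cite: NeukirchANT1999, Ch. III §1 Prop. (1.6) (iv)] -/
theorem galois_smul_classGroupExtend (E : IntermediateField F L) (σ : L ≃ₐ[E] L)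
    (d : ClassGroup (𝓞 E)) :
    ClassGroup.mulEquiv (AmbiguousClass.intAut (σ.restrictScalars F)) (classGroupExtend E L d) =
      classGroupExtend E L d := by
  obtain ⟨I, rfl⟩ := ClassGroup.mk0_surjective d
  rw [classGroupExtend_mk0, AmbiguousClass.mulEquiv_mk0]
  congr 1
  apply Subtype.ext
  change ((I : Ideal (𝓞 E)).map (algebraMap (𝓞 E) (𝓞 L))).map
      (AmbiguousClass.intAut (σ.restrictScalars F) : 𝓞 L →+* 𝓞 L) =
    (I : Ideal (𝓞 E)).map (algebraMap (𝓞 E) (𝓞 L))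
  rw [Ideal.map_map]
  congr 1
  ext x
  exact σ.commutes (x : E)

/-- **`q`-torsion of `Cl(L^H)` ≅ `H`-fixed `q`-torsion of `Cl(L)`** when `gcd(q, [L : L^H]) = 1`: extension
of ideals `i_{L/L^H}` is injective on classes of order prime to the degree (Neukirch III (1.6)(ii)) and every
`Gal(L/L^H)`-invariant class `c` with `c^q = 1` is extended (`c^{[L:L^H]} = i(N c)`, (1.6)(iv)).
[cite: NeukirchANT1999, Ch. III §1 Prop. (1.6) (ii), (iv)] [cite: Washington1997, §10.1] -/
theorem card_torsion_fixed_eq_card_torsion_fixedField (H : Subgroup (L ≃ₐ[F] L)) {q : ℕ}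
    (hcop : Nat.Coprime (Module.finrank (IntermediateField.fixedField H) L) q) :
    Nat.card {c : ClassGroup (𝓞 L) // c ^ q = 1 ∧
        ∀ σ ∈ H, ClassGroup.mulEquiv (AmbiguousClass.intAut σ) c = c} =
      Nat.card {d : ClassGroup (𝓞 (IntermediateField.fixedField H)) // d ^ q = 1} := by
  set E := IntermediateField.fixedField H with hE
  set n := Module.finrank E L with hn
  -- Bezout: `n * a + q * b = 1` over `ℤ`
  have hbez : (n : ℤ) * Nat.gcdA n q + (q : ℤ) * Nat.gcdB n q = 1 := by
    rw [← Nat.gcd_eq_gcd_ab n q, Nat.Coprime.gcd_eq_one hcop]; rfl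
  set a := Nat.gcdA n q
  set bq := Nat.gcdB n q
  -- `Gal(L/E)` restricts into `H`
  have hres : ∀ σ : L ≃ₐ[E] L, σ.restrictScalars F ∈ H := by
    intro σ
    rw [← IntermediateField.fixingSubgroup_fixedField H]
    intro x
    exact σ.commutes x
  have key : ∀ σ : L ≃ₐ[E] L,
      AmbiguousClass.intAut σ = AmbiguousClass.intAut (σ.restrictScalars F) := fun σ => rfl
  symm
  refine Nat.card_congr
    { toFun := fun d => ⟨classGroupExtend E L d.1, ?_, ?_⟩
      invFun := fun c => ⟨(classGroupNorm E L c.1) ^ a, ?_⟩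
      left_inv := ?_
      right_inv := ?_ }
  · rw [← map_pow, d.2, map_one]
  · intro σ hσ
    -- `σ ∈ H` is the restriction of an `E`-automorphism
    have hσ' : σ ∈ IntermediateField.fixingSubgroup E := by
      rw [hE, IntermediateField.fixingSubgroup_fixedField]; exact hσ
    let τ : L ≃ₐ[E] L :=
      { σ with commutes' := fun x => hσ' x }
    have hτ : τ.restrictScalars F = σ := by ext; rfl
    rw [← hτ]
    exact galois_smul_classGroupExtend F L E τ d.1
  · rw [← zpow_natCast, ← zpow_mul, mul_comm, zpow_mul, zpow_natCast, ← map_pow, c.2.1, map_one, one_zpow]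
  · intro d
    apply Subtype.ext
    change classGroupNorm E L (classGroupExtend E L d.1) ^ a = d.1
    rw [classGroupNorm_classGroupExtend, ← zpow_natCast, ← zpow_mul]
    have h1 : d.1 ^ ((q : ℤ) * bq) = 1 := by
      rw [zpow_mul, zpow_natCast, d.2, one_zpow]
    calc d.1 ^ ((n : ℤ) * a) = d.1 ^ ((n : ℤ) * a) * d.1 ^ ((q : ℤ) * bq) := by rw [h1, mul_one]
      _ = d.1 := by rw [← zpow_add, hbez, zpow_one]
  · intro c
    apply Subtype.ext
    change classGroupExtend E L (classGroupNorm E L c.1 ^ a) = c.1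
    have hfix : ∀ σ : L ≃ₐ[E] L, ClassGroup.mulEquiv (AmbiguousClass.intAut σ) c.1 = c.1 :=
      fun σ => by rw [key]; exact c.2.2 _ (hres σ)
    have h2 := pow_finrank_eq_classGroupExtend_classGroupNorm_of_forall_smul_eq E L hfix
    rw [map_zpow, ← h2, ← zpow_natCast, ← zpow_mul]
    have h1 : c.1 ^ ((q : ℤ) * bq) = 1 := by
      rw [zpow_mul, zpow_natCast, c.2.1, one_zpow]
    calc c.1 ^ ((n : ℤ) * a) = c.1 ^ ((n : ℤ) * a) * c.1 ^ ((q : ℤ) * bq) := by rw [h1, mul_one]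
      _ = c.1 := by rw [← zpow_add, hbez, zpow_one]

end ClassGroup

/-! ### §3 Kuroda's relation (odd `q`-torsion form) and the dihedral descent -/

section Kuroda

open NumberField

variable (F L : Type) [Field F] [NumberField F] [Field L] [NumberField L] [Algebra F L] [IsGalois F L]

/-- The subgroup generated by two commuting involutions is `{1, z, b, zb}`. [folklore] -/
private theorem mem_closure_pair_of_involutions {G : Type*} [Group G] {z b : G} (hz : z * z = 1)
    (hb : b * b = 1) (hzb : z * b = b * z) {x : G} (hx : x ∈ Subgroup.closure ({z, b} : Set G)) :
    x = 1 ∨ x = z ∨ x = b ∨ x = z * b := by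
  have hz' : ∀ y, z * (z * y) = y := fun y => by rw [← mul_assoc, hz, one_mul]
  have hb' : ∀ y, b * (b * y) = y := fun y => by rw [← mul_assoc, hb, one_mul]
  have hbz' : ∀ y, b * (z * y) = z * (b * y) := fun y => by rw [← mul_assoc, ← hzb, mul_assoc]
  have hzinv : z⁻¹ = z := inv_eq_of_mul_eq_one_right hz
  have hbinv : b⁻¹ = b := inv_eq_of_mul_eq_one_right hb
  induction hx using Subgroup.closure_induction with
  | mem y hy =>
    rcases hy with rfl | rfl
    · exact Or.inr (Or.inl rfl)
    · exact Or.inr (Or.inr (Or.inl rfl))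
  | one => exact Or.inl rfl
  | mul x y _ _ ihx ihy =>
    rcases ihx with rfl | rfl | rfl | rfl <;> rcases ihy with rfl | rfl | rfl | rfl <;>
      simp [mul_assoc, hz, hb, hz', hbz', ← hzb]
  | inv x _ ih =>
    rcases ih with rfl | rfl | rfl | rfl
    · exact Or.inl inv_one
    · exact Or.inr (Or.inl hzinv)
    · exact Or.inr (Or.inr (Or.inl hbinv))
    · right; right; right
      rw [mul_inv_rev, hzinv, hbinv, ← hzb]

/-- The subgroup generated by an involution is `{1, s}`. [folklore] -/
private theorem mem_zpowers_of_involution {G : Type*} [Group G] {s x : G} (hs : s * s = 1)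
    (hx : x ∈ Subgroup.zpowers s) : x = 1 ∨ x = s := by
  obtain ⟨k, rfl⟩ := Subgroup.mem_zpowers_iff.mp hx
  have hs2 : s ^ (2 : ℤ) = 1 := by rw [zpow_two]; exact hs
  obtain ⟨m, rfl | rfl⟩ := Int.even_or_odd' k
  · left; rw [zpow_mul, hs2, one_zpow]
  · right; rw [zpow_add, zpow_mul, hs2, one_zpow, one_mul, zpow_one]

omit [IsGalois F L] in
/-- `[L : L^⟨s⟩]` is coprime to every odd `q` for an involution `s`. [folklore] -/
private theorem coprime_finrank_fixedField_zpowers (s : L ≃ₐ[F] L) (hs : s * s = 1) {q : ℕ}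
    (hq : Odd q) :
    Nat.Coprime (Module.finrank (IntermediateField.fixedField (Subgroup.zpowers s)) L) q := by
  rw [IntermediateField.finrank_fixedField_eq_card, Nat.card_zpowers]
  have h2 : orderOf s ∣ 2 := orderOf_dvd_of_pow_eq_one (by rw [pow_two]; exact hs)
  exact Nat.Coprime.coprime_dvd_left h2 (Nat.coprime_two_left.mpr hq)

omit [IsGalois F L] in
/-- `[L : L^⟨z,b⟩]` is coprime to every odd `q` for commuting involutions `z, b`. [folklore] -/
private theorem coprime_finrank_fixedField_closure (z b : L ≃ₐ[F] L) (hz : z * z = 1) (hb : b * b = 1)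
    (hzb : z * b = b * z) {q : ℕ} (hq : Odd q) :
    Nat.Coprime (Module.finrank (IntermediateField.fixedField (Subgroup.closure {z, b})) L) q := by
  rw [IntermediateField.finrank_fixedField_eq_card]
  haveI : Fact (Nat.Prime 2) := ⟨Nat.prime_two⟩
  have hP : IsPGroup 2 (Subgroup.closure ({z, b} : Set (L ≃ₐ[F] L))) := by
    intro x
    refine ⟨1, ?_⟩
    apply Subtype.ext
    rw [pow_one, SubgroupClass.coe_pow, OneMemClass.coe_one, pow_two]
    rcases mem_closure_pair_of_involutions hz hb hzb x.2 with h | h | h | h <;> rw [h]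
    · exact one_mul 1
    · exact hz
    · exact hb
    · rw [mul_assoc, ← mul_assoc b z b, ← hzb, mul_assoc, hb, mul_one, hz]
  obtain ⟨n, hn⟩ := IsPGroup.iff_card.mp hP
  rw [hn]
  exact Nat.Coprime.pow_left n (Nat.coprime_two_left.mpr hq)

/-- **Kuroda's class number relation, odd part, `q`-torsion form.**  `L/F` Galois number fields, `z, b`
commuting involutions of `Gal(L/F)`, `q` odd: with `N_E = #{c ∈ Cl(E) : c^q = 1}`,
`N_L · N_{L^⟨z,b⟩}² = N_{L^⟨z⟩} · N_{L^⟨b⟩} · N_{L^⟨zb⟩}` — the biquadratic extension `L/L^⟨z,b⟩` with its three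
intermediate fields; for `q = p` an odd prime this is the `p`-rank relation, for `q = p^n` large the relation
`h_p(L) h_p(k)² = h_p(K₁) h_p(K₂) h_p(K₃)` of `p`-parts. [cite: Lemmermeyer1994, §1 (odd part)]
[cite: NeukirchANT1999, Ch. III §1 Prop. (1.6) (ii), (iv)] -/
theorem card_torsion_classGroup_biquadratic (z b : L ≃ₐ[F] L) (hz : z * z = 1) (hb : b * b = 1)
    (hzb : z * b = b * z) {q : ℕ} (hq : Odd q) :
    Nat.card {c : ClassGroup (𝓞 L) // c ^ q = 1} *
        Nat.card {d : ClassGroup (𝓞 (IntermediateField.fixedField (Subgroup.closure {z, b}))) //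
          d ^ q = 1} ^ 2 =
      Nat.card {d : ClassGroup (𝓞 (IntermediateField.fixedField (Subgroup.zpowers z))) // d ^ q = 1} *
      Nat.card {d : ClassGroup (𝓞 (IntermediateField.fixedField (Subgroup.zpowers b))) // d ^ q = 1} *
      Nat.card {d : ClassGroup (𝓞 (IntermediateField.fixedField (Subgroup.zpowers (z * b)))) //
        d ^ q = 1} := by
  -- the action as endomorphisms
  let act : (L ≃ₐ[F] L) → ClassGroup (𝓞 L) →* ClassGroup (𝓞 L) :=
    fun σ => (ClassGroup.mulEquiv (AmbiguousClass.intAut σ)).toMonoidHom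
  have act_apply : ∀ σ c, act σ c = ClassGroup.mulEquiv (AmbiguousClass.intAut σ) c := fun _ _ => rfl
  have act_mul : ∀ σ τ c, act (σ * τ) c = act σ (act τ c) := by
    intro σ τ c
    rw [act_apply, act_apply, act_apply, AmbiguousClass.mulEquiv_intAut_mul, MulEquiv.trans_apply]
  have act_one : ∀ c, act 1 c = c := by
    intro c; rw [act_apply, AmbiguousClass.mulEquiv_intAut_one, MulEquiv.refl_apply]
  have haz : ∀ c, act z (act z c) = c := fun c => by rw [← act_mul, hz, act_one]
  have hab : ∀ c, act b (act b c) = c := fun c => by rw [← act_mul, hb, act_one]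
  have hazb : ∀ c, act z (act b c) = act b (act z c) := fun c => by rw [← act_mul, hzb, act_mul]
  have hzbzb : (z * b) * (z * b) = 1 := by
    rw [mul_assoc, ← mul_assoc b z b, ← hzb, mul_assoc, hb, mul_one, hz]
  -- §1 for `(Cl(L), act z, act b)`
  have main := card_torsion_mul_card_fixed_sq (act z) (act b) haz hab hazb hq
  -- §2 for the four subgroups
  have eZ := card_torsion_fixed_eq_card_torsion_fixedField F L (Subgroup.zpowers z)
    (coprime_finrank_fixedField_zpowers F L z hz hq)
  have eB := card_torsion_fixed_eq_card_torsion_fixedField F L (Subgroup.zpowers b)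
    (coprime_finrank_fixedField_zpowers F L b hb hq)
  have eZB := card_torsion_fixed_eq_card_torsion_fixedField F L (Subgroup.zpowers (z * b))
    (coprime_finrank_fixedField_zpowers F L (z * b) hzbzb hq)
  have eV := card_torsion_fixed_eq_card_torsion_fixedField F L (Subgroup.closure {z, b})
    (coprime_finrank_fixedField_closure F L z b hz hb hzb hq)
  -- fixedness under a subgroup generated by involutions = fixedness under the generators
  have fz : ∀ (s : L ≃ₐ[F] L), s * s = 1 → ∀ c : ClassGroup (𝓞 L),
      (∀ σ ∈ Subgroup.zpowers s, ClassGroup.mulEquiv (AmbiguousClass.intAut σ) c = c) ↔ act s c = c := by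
    intro s hs c
    constructor
    · intro h; exact h s (Subgroup.mem_zpowers s)
    · intro h σ hσ
      rcases mem_zpowers_of_involution hs hσ with rfl | rfl
      · exact act_one c
      · exact h
  have fV : ∀ c : ClassGroup (𝓞 L),
      (∀ σ ∈ Subgroup.closure ({z, b} : Set (L ≃ₐ[F] L)),
        ClassGroup.mulEquiv (AmbiguousClass.intAut σ) c = c) ↔ act z c = c ∧ act b c = c := by
    intro c
    constructor
    · intro h
      exact ⟨h z (Subgroup.subset_closure (by simp)), h b (Subgroup.subset_closure (by simp))⟩
    · rintro ⟨h1, h2⟩ σ hσ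
      rcases mem_closure_pair_of_involutions hz hb hzb hσ with rfl | rfl | rfl | rfl
      · exact act_one c
      · exact h1
      · exact h2
      · rw [← act_apply, act_mul, h2, h1]
  rw [← eZ, ← eB, ← eZB, ← eV]
  rw [Nat.card_congr (Equiv.subtypeEquivRight fun c => and_congr_right fun _ => fV c),
    Nat.card_congr (Equiv.subtypeEquivRight fun c => and_congr_right fun _ => fz z hz c),
    Nat.card_congr (Equiv.subtypeEquivRight fun c => and_congr_right fun _ => fz b hb c),
    Nat.card_congr (Equiv.subtypeEquivRight fun c => and_congr_right fun _ => fz (z * b) hzbzb c)]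
  have e3 : Nat.card {c : ClassGroup (𝓞 L) // c ^ q = 1 ∧ act (z * b) c = c} =
      Nat.card {c : ClassGroup (𝓞 L) // c ^ q = 1 ∧ act z (act b c) = c} :=
    Nat.card_congr (Equiv.subtypeEquivRight fun c => by rw [act_mul])
  rw [e3]
  exact main

/-- **The dihedral / semidihedral descent** (`#Cl(L)[q] · #Cl(k)[q]² = #Cl(X)[q] · #Cl(K)[q]²`).  If moreover
`zb` is CONJUGATE to `b` in `Gal(L/F)` (`zb = g b g⁻¹`; e.g. `G = D₄` or `SD₁₆` with `z` the central involution
and `b` a non-central one — the Galois groups of `ℚ(E[3])` with Cartan-normaliser image, `k = ℚ(x(P))`,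
`X = ℚ(x(E[3]))`, `K = ℚ(P)`), then `N_{L^⟨zb⟩} = N_{L^⟨b⟩}` and Kuroda's relation reads
`N_L · N_{L^⟨z,b⟩}² = N_{L^⟨z⟩} · N_{L^⟨b⟩}²`. [cite: Lemmermeyer1994, §1 (odd part)]
[cite: NeukirchANT1999, Ch. III §1 Prop. (1.6) (ii), (iv)] -/
theorem card_torsion_classGroup_dihedral (z b g : L ≃ₐ[F] L) (hz : z * z = 1) (hb : b * b = 1)
    (hzb : z * b = b * z) (hconj : z * b = g * b * g⁻¹) {q : ℕ} (hq : Odd q) :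
    Nat.card {c : ClassGroup (𝓞 L) // c ^ q = 1} *
        Nat.card {d : ClassGroup (𝓞 (IntermediateField.fixedField (Subgroup.closure {z, b}))) //
          d ^ q = 1} ^ 2 =
      Nat.card {d : ClassGroup (𝓞 (IntermediateField.fixedField (Subgroup.zpowers z))) // d ^ q = 1} *
      Nat.card {d : ClassGroup (𝓞 (IntermediateField.fixedField (Subgroup.zpowers b))) // d ^ q = 1} ^ 2 := by
  rw [card_torsion_classGroup_biquadratic F L z b hz hb hzb hq, pow_two, mul_assoc]
  congr 2
  -- `N_{L^⟨zb⟩} = N_{L^⟨b⟩}` by transporting fixed classes along `g`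
  let act : (L ≃ₐ[F] L) → ClassGroup (𝓞 L) →* ClassGroup (𝓞 L) :=
    fun σ => (ClassGroup.mulEquiv (AmbiguousClass.intAut σ)).toMonoidHom
  have act_apply : ∀ σ c, act σ c = ClassGroup.mulEquiv (AmbiguousClass.intAut σ) c := fun _ _ => rfl
  have act_mul : ∀ σ τ c, act (σ * τ) c = act σ (act τ c) := by
    intro σ τ c
    rw [act_apply, act_apply, act_apply, AmbiguousClass.mulEquiv_intAut_mul, MulEquiv.trans_apply]
  have act_one : ∀ c, act 1 c = c := by
    intro c; rw [act_apply, AmbiguousClass.mulEquiv_intAut_one, MulEquiv.refl_apply]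
  have hzbzb : (z * b) * (z * b) = 1 := by
    rw [mul_assoc, ← mul_assoc b z b, ← hzb, mul_assoc, hb, mul_one, hz]
  have fz : ∀ (s : L ≃ₐ[F] L), s * s = 1 → ∀ c : ClassGroup (𝓞 L),
      (∀ σ ∈ Subgroup.zpowers s, ClassGroup.mulEquiv (AmbiguousClass.intAut σ) c = c) ↔ act s c = c := by
    intro s hs c
    constructor
    · intro h; exact h s (Subgroup.mem_zpowers s)
    · intro h σ hσ
      rcases mem_zpowers_of_involution hs hσ with rfl | rfl
      · exact act_one c
      · exact h
  rw [← card_torsion_fixed_eq_card_torsion_fixedField F L (Subgroup.zpowers (z * b))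
      (coprime_finrank_fixedField_zpowers F L (z * b) hzbzb hq),
    ← card_torsion_fixed_eq_card_torsion_fixedField F L (Subgroup.zpowers b)
      (coprime_finrank_fixedField_zpowers F L b hb hq),
    Nat.card_congr (Equiv.subtypeEquivRight fun c => and_congr_right fun _ => fz (z * b) hzbzb c),
    Nat.card_congr (Equiv.subtypeEquivRight fun c => and_congr_right fun _ => fz b hb c)]
  -- `c ↦ g c` maps the `b`-fixed torsion classes onto the `zb = g b g⁻¹`-fixed ones
  have hzb' : act (z * b) = act (g * b * g⁻¹) := by rw [hconj]
  have to_ok : ∀ x : ClassGroup (𝓞 L), act b x = x → act (z * b) (act g x) = act g x := by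
    intro x hx
    rw [hzb', act_mul, act_mul, ← act_mul g⁻¹ g, inv_mul_cancel, act_one, hx]
  have inv_ok : ∀ x : ClassGroup (𝓞 L), act (z * b) x = x → act b (act g⁻¹ x) = act g⁻¹ x := by
    intro x hx
    rw [hzb', act_mul, act_mul] at hx
    have h2 := congrArg (act g⁻¹) hx
    rwa [← act_mul g⁻¹ g, inv_mul_cancel, act_one] at h2
  symm
  exact Nat.card_congr
    { toFun := fun c => ⟨act g c.1, by rw [← map_pow, c.2.1, map_one], to_ok c.1 c.2.2⟩
      invFun := fun c => ⟨act g⁻¹ c.1, by rw [← map_pow, c.2.1, map_one], inv_ok c.1 c.2.2⟩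
      left_inv := fun c => by
        ext; change act g⁻¹ (act g c.1) = c.1; rw [← act_mul, inv_mul_cancel, act_one]
      right_inv := fun c => by
        ext; change act g (act g⁻¹ c.1) = c.1; rw [← act_mul, mul_inv_cancel, act_one] }

end Kuroda

end Literature.NumberTheory.NumberFields.KurodaOddPart

end
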